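import Literature.Probability.RandomPlanarGeometry.PlanarDomains
import HarnessLib

/-!
# No long fingers: a Jordan domain minus small balls at its marked points has one big piece
# (piece (M3a) of stub 5a4″ `stub_carvedReduction_squeezeSolid`)

Piece of stub 5a4″ `stub_carvedReduction_squeezeSolid`
(`TwoPieceAdmRestrictionLimit → MovingCarvingSqueezeP FatAnchoredClassZeroSolid`) of the line
`bridge-gate-renewal` (r10) of the crux `SAWDefectDecoherence.ObservableToSLER`
(stmt-CriticalPhenomena-14005; twin T-A `stub_carvedReduction_squeezeGeometry` of stmt-CriticalPhenomena-10472),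
clause (C2) of its conclusion (the inner domain `M + τ` has its boundary LOOP `η`-close to that
of `D`, parameter by parameter).  The carvings live in `B(D.pt i, 2R₀)`; whatever they cut off
from the bulk must then lie within `o(1)` of `D.pt i` as `R₀ → 0`, or no inner domain avoiding
the carving can have a boundary loop `η`-close to `D`'s (a lobe of `D` beyond a neck through
`B(D.pt 0, 2R₀)` would be lost).  This is the choice of the locality radius `R₀ = R₀(D, η)`:

* `stub_carvedReduction_noLongFingers` — for a homeomorphism `H` of `ℂ` (the Schoenflies map of
  `D`, `stub_carvedReduction_jordanApprox` p130751), finitely many unit vectors `w i` and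
  `ε > 0` there are `δ > 0` and an OPEN CONNECTED `U ⊆ H(𝔻)` missing the closed `δ`-balls about
  the points `H (w i)` and containing every point of `H(𝔻)` at distance `≥ ε` from all of them:
  all of `H(𝔻)` but the `ε`-balls lies in ONE component of `H(𝔻)` minus the `δ`-balls.
  (Pull back by `H`: the far set is a compact part of the closed disc missing the `w i`, hence
  missing small CAPS `{Re (ζ w̄ᵢ) ≥ 1 - s}`; the disc minus the caps is convex.)
* `noLongFingers_domain` — the same for a Dobrushin domain presented by its Schoenflies map.

Sources: Ch. Pommerenke, Boundary Behaviour of Conformal Maps (1992) §2.2 (local connectivity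
of Jordan domains); M. H. A. Newman, Elements of the topology of plane sets of points (1939) VI §4.
-/

noncomputable section
open scoped Topology
open Filter Set Metric
open Literature.Probability.RandomPlanarGeometry

namespace Summit.CriticalPhenomena.SAWScalingLimit.Theorems.ObservableToSLER.Squeeze

/-- The cap `{ζ ∈ 𝔻̄ | 1 - s ≤ Re (ζ w̄)}` of the closed unit disc at the unit vector `w` lies in
the closed ball of radius `√(2 s)` about `w`. -/
theorem norm_sub_le_of_cap {w ζ : ℂ} {s : ℝ} (hw : ‖w‖ = 1) (hζ : ‖ζ‖ ≤ 1)
    (hre : 1 - s ≤ (ζ * (starRingEnd ℂ) w).re) : ‖ζ - w‖ ^ 2 ≤ 2 * s := by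
  have key : ‖ζ - w‖ ^ 2 = ‖ζ‖ ^ 2 + ‖w‖ ^ 2 - 2 * (ζ * (starRingEnd ℂ) w).re := by
    rw [← Complex.normSq_eq_norm_sq, ← Complex.normSq_eq_norm_sq, ← Complex.normSq_eq_norm_sq,
      Complex.normSq_sub]
  rw [key, hw]
  nlinarith [norm_nonneg ζ]

/-- A point of the closed unit disc close to the unit vector `w` lies in the cap
`{Re (ζ w̄) > 1 - s}` as soon as its distance to `w` is `< s`. -/
theorem cap_of_norm_sub_lt {w ζ : ℂ} {s : ℝ} (hw : ‖w‖ = 1) (h : ‖ζ - w‖ < s) :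
    1 - s < (ζ * (starRingEnd ℂ) w).re := by
  have h1 : (w * (starRingEnd ℂ) w).re = 1 := by
    rw [Complex.mul_conj, Complex.ofReal_re, Complex.normSq_eq_norm_sq, hw]
    norm_num
  have h2 : |((ζ - w) * (starRingEnd ℂ) w).re| < s := by
    refine (Complex.abs_re_le_norm _).trans_lt ?_
    rw [norm_mul, Complex.norm_conj, hw, mul_one]
    exact h
  have h3 : ((ζ - w) * (starRingEnd ℂ) w).re = (ζ * (starRingEnd ℂ) w).re - 1 := by
    rw [sub_mul, Complex.sub_re, h1]
  rw [h3] at h2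
  have := (abs_lt.1 h2).1
  linarith

/-- **Registered sub-goal `stub_carvedReduction_noLongFingers`** (crux item stmt-CriticalPhenomena-14005,
stub 5a4″ `stub_carvedReduction_squeezeSolid`, piece (M3a) NO LONG FINGERS): for a homeomorphism
`H` of `ℂ`, finitely many unit vectors `w i` and `ε > 0`, there are `δ > 0` and an open connected
`U ⊆ H '' ball 0 1`, disjoint from every `closedBall (H (w i)) δ`, containing
`H '' ball 0 1 ∖ ⋃ i, ball (H (w i)) ε`. -/
theorem stub_carvedReduction_noLongFingers :
    ∀ {ι : Type*} [Fintype ι] (H : ℂ ≃ₜ ℂ) (w : ι → ℂ) (ε : ℝ), (∀ i, ‖w i‖ = 1) → 0 < ε →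
      ∃ δ > (0 : ℝ), ∃ U : Set ℂ, IsOpen U ∧ IsConnected U ∧ U ⊆ H '' ball 0 1 ∧
        (∀ i, Disjoint U (closedBall (H (w i)) δ)) ∧
        H '' ball 0 1 \ (⋃ i, ball (H (w i)) ε) ⊆ U := by
  intro ι _ H w ε hw hε
  classical
  -- the far set, pulled back to the closed disc: compact and missing every `w i`
  set K : Set ℂ := closedBall (0 : ℂ) 1 ∩ H ⁻¹' (⋃ i, ball (H (w i)) ε)ᶜ with hK
  have hKc : IsCompact K :=
    (isCompact_closedBall _ _).inter_right
      ((isOpen_iUnion fun i => isOpen_ball).isClosed_compl.preimage H.continuous)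
  have hwK : ∀ i, w i ∉ K := fun i h => h.2 (mem_iUnion.2 ⟨i, mem_ball_self hε⟩)
  -- a common radius `κ₀ ∈ (0, 1)` with `closedBall (w i) κ₀ ∩ K = ∅`
  obtain ⟨κ₀, hκ₀, hκ₀1, hκ₀K⟩ : ∃ κ₀ : ℝ, 0 < κ₀ ∧ κ₀ < 1 ∧ ∀ i, ∀ ζ ∈ K, κ₀ < ‖ζ - w i‖ := by
    have hex : ∀ i, ∃ κ : ℝ, 0 < κ ∧ ∀ ζ ∈ K, κ < ‖ζ - w i‖ := by
      intro i
      by_cases hKne : K.Nonempty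
      · obtain ⟨ζ₀, hζ₀K, hζ₀⟩ :=
          hKc.exists_isMinOn hKne ((continuous_id.sub continuous_const).norm.continuousOn (s := K))
        have hpos : 0 < ‖ζ₀ - w i‖ := norm_pos_iff.2 (sub_ne_zero.2 fun h => hwK i (h ▸ hζ₀K))
        refine ⟨‖ζ₀ - w i‖ / 2, half_pos hpos, fun ζ hζ => ?_⟩
        have hmin : ‖ζ₀ - w i‖ ≤ ‖ζ - w i‖ := by
          have := hζ₀ hζ
          simpa using this
        linarith
      · refine ⟨1, one_pos, fun ζ hζ => (hKne ⟨ζ, hζ⟩).elim⟩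
    choose κ hκpos hκ using hex
    by_cases hι : Nonempty ι
    · obtain ⟨i₀, hi₀⟩ := Finite.exists_min κ
      refine ⟨min (κ i₀) (1 / 2), lt_min (hκpos i₀) (by norm_num), (min_le_right _ _).trans_lt (by norm_num),
        fun i ζ hζ => (min_le_left _ _).trans_lt ((hi₀ i).trans_lt (hκ i ζ hζ))⟩
    · exact ⟨1 / 2, by norm_num, by norm_num, fun i => (hι ⟨i⟩).elim⟩
  -- the convex piece `V`: the open disc minus the caps of depth `s = κ₀² / 2`
  set s : ℝ := κ₀ ^ 2 / 2 with hs
  have hs0 : 0 < s := by positivity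
  have hs1 : s < 1 := by
    have : κ₀ ^ 2 < 1 := by nlinarith
    rw [hs]; linarith
  set V : Set ℂ := ball (0 : ℂ) 1 ∩ ⋂ i, {ζ : ℂ | (ζ * (starRingEnd ℂ) (w i)).re < 1 - s} with hV
  have hVo : IsOpen V := by
    refine isOpen_ball.inter (isOpen_iInter_of_finite fun i => ?_)
    exact isOpen_lt (Complex.continuous_re.comp (continuous_id.mul continuous_const)) continuous_const
  have hVconv : Convex ℝ V := by
    refine (convex_ball _ _).inter (convex_iInter fun i => ?_)
    have hlin : IsLinearMap ℝ fun ζ : ℂ => (ζ * (starRingEnd ℂ) (w i)).re :=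
      { map_add := fun x y => by simp [add_mul]
        map_smul := fun c x => by simp [Complex.real_smul, mul_assoc] }
    exact convex_halfSpace_lt hlin (1 - s)
  have h0V : (0 : ℂ) ∈ V := by
    refine ⟨mem_ball_self one_pos, mem_iInter.2 fun i => ?_⟩
    simp only [mem_setOf_eq, zero_mul, Complex.zero_re]
    linarith
  have hVc : IsConnected V := ⟨⟨0, h0V⟩, hVconv.isPreconnected⟩
  have hVball : V ⊆ ball 0 1 := inter_subset_left
  -- `K ∩ ball ⊆ V`
  have hKV : ∀ ζ ∈ K, ζ ∈ ball (0 : ℂ) 1 → ζ ∈ V := by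
    intro ζ hζK hζb
    refine ⟨hζb, mem_iInter.2 fun i => ?_⟩
    simp only [mem_setOf_eq]
    by_contra hge
    push Not at hge
    have hcap := norm_sub_le_of_cap (hw i) (mem_closedBall_zero_iff.1 hζK.1) hge
    have hfar := hκ₀K i ζ hζK
    have : κ₀ ^ 2 < ‖ζ - w i‖ ^ 2 := by
      have h0 : 0 ≤ κ₀ := hκ₀.le
      nlinarith
    rw [hs] at hcap
    linarith
  -- the radius `δ`: `H⁻¹ (closedBall (H (w i)) δ) ⊆ ball (w i) s`
  obtain ⟨δ, hδ, hδs⟩ : ∃ δ > (0 : ℝ), ∀ i, ∀ y, dist y (H (w i)) ≤ δ → ‖H.symm y - w i‖ < s := by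
    have hex : ∀ i, ∃ δ > (0 : ℝ), ∀ y, dist y (H (w i)) ≤ δ → ‖H.symm y - w i‖ < s := by
      intro i
      have hc : ContinuousAt H.symm (H (w i)) := H.symm.continuous.continuousAt
      obtain ⟨δ, hδ, hδ'⟩ := Metric.continuousAt_iff.1 hc s hs0
      refine ⟨δ / 2, half_pos hδ, fun y hy => ?_⟩
      have := hδ' (show dist y (H (w i)) < δ by linarith)
      rwa [H.symm_apply_apply, dist_eq_norm] at this
    choose δ hδpos hδ using hex
    by_cases hι : Nonempty ι
    · obtain ⟨i₀, hi₀⟩ := Finite.exists_min δ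
      exact ⟨δ i₀, hδpos i₀, fun i y hy => hδ i y (hy.trans (hi₀ i))⟩
    · exact ⟨1, one_pos, fun i => (hι ⟨i⟩).elim⟩
  refine ⟨δ, hδ, H '' V, H.isOpenMap V hVo, hVc.image H H.continuous.continuousOn,
    image_mono hVball, fun i => ?_, ?_⟩
  · refine Set.disjoint_left.2 ?_
    rintro y ⟨ζ, hζV, rfl⟩ hy
    have hlt := hδs i (H ζ) (mem_closedBall.1 hy)
    rw [H.symm_apply_apply] at hlt
    have hcap := cap_of_norm_sub_lt (hw i) hlt
    have hV' := mem_iInter.1 hζV.2 i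
    simp only [mem_setOf_eq] at hV'
    linarith
  · rintro y ⟨⟨ζ, hζb, rfl⟩, hy⟩
    refine ⟨ζ, hKV ζ ⟨ball_subset_closedBall hζb, ?_⟩ hζb, rfl⟩
    simpa using hy

/-- **No long fingers, for a Dobrushin domain presented by a Schoenflies map** (the form the
squeeze consumes, with `H`, `u` from `stub_carvedReduction_jordanApprox`): for `ε > 0` there are
`δ > 0` and an open connected `U ⊆ D` missing the closed `δ`-balls about the marked points and
containing every point of `D` outside the open `ε`-balls about them. -/
theorem noLongFingers_domain (D : DobrushinDomain) (H : ℂ ≃ₜ ℂ) (u : ℝ → ℂ)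
    (hH : H '' ball 0 1 = D.carrier) (hu : ∀ t, u t ∈ sphere (0 : ℂ) 1)
    (hpt : ∀ i, D.pt i = H (u (D.mark i))) {ε : ℝ} (hε : 0 < ε) :
    ∃ δ > (0 : ℝ), ∃ U : Set ℂ, IsOpen U ∧ IsConnected U ∧ U ⊆ D.carrier ∧
      (∀ i, Disjoint U (closedBall (D.pt i) δ)) ∧
      D.carrier \ (⋃ i, ball (D.pt i) ε) ⊆ U := by
  have hw : ∀ i : Fin 2, ‖u (D.mark i)‖ = 1 := fun i => mem_sphere_zero_iff_norm.1 (hu _)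
  obtain ⟨δ, hδ, U, hUo, hUc, hUsub, hUdisj, hUfar⟩ :=
    stub_carvedReduction_noLongFingers H (fun i : Fin 2 => u (D.mark i)) ε hw hε
  refine ⟨δ, hδ, U, hUo, hUc, hH ▸ hUsub, fun i => (hpt i).symm ▸ hUdisj i, ?_⟩
  rw [← hH]
  intro z hz
  refine hUfar ⟨hz.1, fun h => hz.2 ?_⟩
  obtain ⟨i, hi⟩ := mem_iUnion.1 h
  exact mem_iUnion.2 ⟨i, (hpt i).symm ▸ hi⟩

end Summit.CriticalPhenomena.SAWScalingLimit.Theorems.ObservableToSLER.Squeeze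

end
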